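import Summits.CriticalPhenomena.PercolationContinuityZ3.Theorems.PercNearOneGluingNoHeavyQuantTwoPointPairRouteBallPowerLaw
import Summits.CriticalPhenomena.PercolationContinuityZ3.Theorems.PercNearOneGluingNoHeavyQuantTwoPointPairRouteZ3
import HarnessLib

/-!
# QUANT lane / PAPER-2 rate track (ARM-2, gen 9): THE FREE-PARTNER PAIR ROUTE ON `ℤ³` IN NUMERALS
# — X_A(3,a,C) ⟹ `π_{p_c(ℤ³)}(n) ≤ (2^66 + 3√C)·n^{−min(a,1)/90}` and `θ(p) ≤ 2^144 (C+1) (p − p_c)^{2a′/(270−a′)}`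

builds on p205010 (kernel theorem, internal audit signed; external expert review pending)

Cell `prim-quant`, seat `prim-quant-arm-2` (constants bookkeeper), memo `RATE-CONSTANTS.md` §5.5.  Proof-only numerals file on top of
`…QuantTwoPointPairRouteBallPowerLaw.lean` (`Quant.oneArmPolyDecayAtCritical_of_minTwoPoint_pair` / `…_of_ballTwoPoint_pair`: exponent
`min(·,1)/(8d²+4d+6)`, constant `195^c·(2√C + K′_d)`), with `κ_3 = aknKappa 3 (1/6) ≤ 2^411` (`…QuantDktWindowNumerals`):
`K′_3 = (10√2·27·6^{14}·90·7^{18}·κ_3)^{1/8} ≤ (2^{109}·2^{411})^{1/8} = 2^{65}` (`Quant.pairConstBall_three_le`), `195^c ≤ 6/5` (`c ≤ 1/40`,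
`Quant.rpow_195_le`), hence the registry rows **`OneArmPolyDecayAtCritical 3 (min(b,1)/90) (2^66 + 3√C)`** from a dip in every ball
(`Quant.oneArmPolyDecayAtCritical_Z3_of_minTwoPoint_pair`) and from X_A (`…_of_ballTwoPoint_pair`), the printed sentence
`Quant.oneArm_powerLaw_Z3_of_ballTwoPoint_pair`, and through the lane's Newman/two-box transfer (`thetaHolder_Z3_of_oneArmPolyDecay_numeral'`,
`c = a′/90 ≤ 1/4`) the Hölder companion **`ThetaHolderNearCritical 3 (2a′/(270 − a′)) (2^144 (C+1))`**
(`Quant.thetaHolder_Z3_of_ballTwoPoint_pair`; exponent `2/269` at `a′ = 1` against `2/1319` packaged zone, `2/749` free ε).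
COMPARISON on `ℤ³` under the SAME hypothesis X_A(3,a,C) (`a′ = min(a,1)`; all conditional, all kernel): packaged zone `2^11√(C+1)·n^{−a′/440}`
(kick-in `2^{4840/a′}`), free-ε zone `2^44√(C+1)·n^{−a′/250}` (kick-in `2^{11000/a′}`), **pair route `(2^66 + 3√C)·n^{−a′/90}` (kick-in
`2^{5940/a′}`)**; crossover with the packaged row at `n ≈ 2^{6170/a′}`, beyond which the pair route is smaller by `n^{−7a′/792}`.
HONEST FRAMING: implications from the OPEN input X_A (`a ≈ 0.95` numerically on `ℤ³`, open in print for `3 ≤ d ≤ 10`); class log*,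
display `1 − 2⁻¹⁹⁸⁶`, honest sentence UNCHANGED.
[cite: Cerf2015, Lemma 6.1, Lemma 7.1 and §10] [cite: DuminilcopinKozmaTassion2020, §7 (38)–(40)] [cite: HeydenreichVanDerHofstad2017, Open Problem 10.1]
[cite: Newman1987BetaDelta, Theorem (β ≥ 2/δ)]
-/

noncomputable section

namespace Summit.CriticalPhenomena.PercolationContinuityZ3.Theorems.Quant

open MeasureTheory Literature.Probability.Percolation Literature.Probability.LatticeModels
open Summit.CriticalPhenomena.PercolationContinuityZ3.Theorems.SurfaceTension
open Literature.Probability.Percolation.AKN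
open scoped Classical

/-- The free-partner pair-route constant on `ℤ³`: `K′_3 = (10√2·27·6^{14}·90·7^{18}·κ_3)^{1/8} ≤ 2^{65}` (`κ_3 = aknKappa 3 (1/6) ≤ 2^411`;
`15·27·90·6^{14}·7^{18} ≤ 2^{109}`). [cite: Cerf2015, Prop. 5.2] [cite: DuminilcopinKozmaTassion2020, §7 (38)] -/
theorem pairConstBall_three_le :
    (10 * Real.sqrt 2 * (((3 : ℕ) : ℝ)) ^ 3 * (2 * (((3 : ℕ) : ℝ))) ^ (4 * 3 + 2) * (8 * (((3 : ℕ) : ℝ)) ^ 2 + 4 * ((3 : ℕ) : ℝ) + 6) *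
        7 ^ (2 * 3 ^ 2) * aknKappa 3 (1 / (2 * (((3 : ℕ) : ℝ))))) ^ (1 / (2 * (((3 : ℕ) : ℝ)) + 2)) ≤ (2 : ℝ) ^ (65 : ℕ) := by
  have hsix : (1 / (2 * (((3 : ℕ) : ℝ))) : ℝ) = 1 / 6 := by norm_num
  have hexp : (1 / (2 * (((3 : ℕ) : ℝ)) + 2) : ℝ) = 1 / 8 := by norm_num
  rw [hsix, hexp]
  have hκ := aknKappa_three_sixth_le
  have hκ0 : 0 ≤ aknKappa 3 (1 / 6) := le_trans (by norm_num) (three_le_aknKappa 3 _)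
  have hs2 : Real.sqrt 2 ≤ 3 / 2 := by
    rw [show (3 / 2 : ℝ) = Real.sqrt ((3 / 2) ^ 2) by rw [Real.sqrt_sq (by norm_num)]]
    exact Real.sqrt_le_sqrt (by norm_num)
  have hs0 : 0 ≤ Real.sqrt 2 := Real.sqrt_nonneg 2
  set K3 : ℝ := 10 * Real.sqrt 2 * (((3 : ℕ) : ℝ)) ^ 3 * (2 * (((3 : ℕ) : ℝ))) ^ (4 * 3 + 2) *
      (8 * (((3 : ℕ) : ℝ)) ^ 2 + 4 * ((3 : ℕ) : ℝ) + 6) * 7 ^ (2 * 3 ^ 2) * aknKappa 3 (1 / 6) with hK3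
  have hK3le : K3 ≤ (2 : ℝ) ^ (520 : ℕ) := by
    have e1 : 4 * 3 + 2 = 14 := by norm_num
    have e2 : 2 * 3 ^ 2 = 18 := by norm_num
    have h1 : K3 = (10 * 27 * 6 ^ 14 * 90 * 7 ^ 18) * Real.sqrt 2 * aknKappa 3 (1 / 6) := by
      rw [hK3, e1, e2]; push_cast; ring
    rw [h1]
    calc (10 * 27 * 6 ^ 14 * 90 * 7 ^ 18 : ℝ) * Real.sqrt 2 * aknKappa 3 (1 / 6)
        ≤ (10 * 27 * 6 ^ 14 * 90 * 7 ^ 18) * (3 / 2) * (2 : ℝ) ^ 411 :=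
          mul_le_mul (mul_le_mul_of_nonneg_left hs2 (by norm_num)) hκ hκ0 (by positivity)
      _ ≤ (2 : ℝ) ^ (109 : ℕ) * (2 : ℝ) ^ 411 := mul_le_mul_of_nonneg_right (by norm_num) (by positivity)
      _ = (2 : ℝ) ^ (520 : ℕ) := by rw [← pow_add]
  have hK30 : 0 ≤ K3 := by rw [hK3]; exact mul_nonneg (by positivity) hκ0
  have h2 : ((2 : ℝ) ^ (520 : ℕ)) ^ (1 / 8 : ℝ) = (2 : ℝ) ^ (65 : ℕ) := by
    rw [show ((2 : ℝ) ^ (520 : ℕ)) = ((2 : ℝ) ^ (65 : ℕ)) ^ (8 : ℕ) by rw [← pow_mul], ← Real.rpow_natCast ((2 : ℝ) ^ (65 : ℕ)) 8,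
      ← Real.rpow_mul (by positivity)]
    norm_num
  calc K3 ^ (1 / 8 : ℝ) ≤ ((2 : ℝ) ^ (520 : ℕ)) ^ (1 / 8 : ℝ) := Real.rpow_le_rpow hK30 hK3le (by norm_num)
    _ = (2 : ℝ) ^ (65 : ℕ) := h2

/-- **A DIP IN EVERY BALL ⟹ (T1) ON `ℤ³`, PAIR ROUTE (registry form)**: if every `Λ_D` (`D ≥ 1`) contains `v` with
`τ_{p_c}(0,v) ≤ C D^{−b}` (`b > 0`), then `OneArmPolyDecayAtCritical 3 (min(b,1)/90) (2^66 + 3√C)`.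
builds on p205010 (kernel theorem, internal audit signed; external expert review pending).
[cite: Cerf2015, Lemma 6.1, Lemma 7.1 and §10] [cite: DuminilcopinKozmaTassion2020, §7 (38)–(40)] [cite: HeydenreichVanDerHofstad2017, Open Problem 10.1] -/
theorem oneArmPolyDecayAtCritical_Z3_of_minTwoPoint_pair {b C : ℝ} (hb0 : 0 < b)
    (hmin : ∀ D : ℕ, 1 ≤ D → ∃ v ∈ box 3 D, tau 3 (criticalProbI 3) 0 v ≤ C * (D : ℝ) ^ (-b)) :
    OneArmPolyDecayAtCritical 3 (min b 1 / 90) ((2 : ℝ) ^ (66 : ℕ) + 3 * Real.sqrt C) := by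
  have h := oneArmPolyDecayAtCritical_of_minTwoPoint_pair (d := 3) (by norm_num) hb0 hmin
  have h90 : (8 * (((3 : ℕ) : ℝ)) ^ 2 + 4 * ((3 : ℕ) : ℝ) + 6) = 90 := by norm_num
  have hexp : min b 1 / (8 * (((3 : ℕ) : ℝ)) ^ 2 + 4 * ((3 : ℕ) : ℝ) + 6) = min b 1 / 90 := by rw [h90]
  rw [hexp] at h
  refine oneArmPolyDecayAtCritical_const_mono h ?_
  have hK := pairConstBall_three_le
  have hc0 : 0 ≤ min b 1 / 90 := by have := lt_min hb0 one_pos; positivity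
  have hc1 : min b 1 / 90 ≤ 1 / 40 := by have := min_le_right b 1; linarith
  have h195 := rpow_195_le hc0 hc1
  have hsC : 0 ≤ Real.sqrt C := Real.sqrt_nonneg C
  have hK0 : 0 ≤ (10 * Real.sqrt 2 * (((3 : ℕ) : ℝ)) ^ 3 * (2 * (((3 : ℕ) : ℝ))) ^ (4 * 3 + 2) *
      (8 * (((3 : ℕ) : ℝ)) ^ 2 + 4 * ((3 : ℕ) : ℝ) + 6) * 7 ^ (2 * 3 ^ 2) * aknKappa 3 (1 / (2 * (((3 : ℕ) : ℝ))))) ^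
        (1 / (2 * (((3 : ℕ) : ℝ)) + 2)) :=
    Real.rpow_nonneg (mul_nonneg (by positivity) (le_trans (by norm_num) (three_le_aknKappa 3 _))) _
  have h0 : 0 ≤ (195 : ℝ) ^ (min b 1 / 90) := Real.rpow_nonneg (by norm_num) _
  calc (195 : ℝ) ^ (min b 1 / 90) * (2 * Real.sqrt C + (10 * Real.sqrt 2 * (((3 : ℕ) : ℝ)) ^ 3 * (2 * (((3 : ℕ) : ℝ))) ^ (4 * 3 + 2) *
          (8 * (((3 : ℕ) : ℝ)) ^ 2 + 4 * ((3 : ℕ) : ℝ) + 6) * 7 ^ (2 * 3 ^ 2) * aknKappa 3 (1 / (2 * (((3 : ℕ) : ℝ))))) ^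
            (1 / (2 * (((3 : ℕ) : ℝ)) + 2)))
      ≤ (6 / 5) * (2 * Real.sqrt C + (2 : ℝ) ^ (65 : ℕ)) :=
        mul_le_mul h195 (by linarith) (by positivity) (by norm_num)
    _ ≤ (2 : ℝ) ^ (66 : ℕ) + 3 * Real.sqrt C := by nlinarith only [hsC]

/-- **X_A ⟹ (T1) ON `ℤ³`, PAIR ROUTE (registry form)**: `Σ_{x ∈ Λ_R} τ_{p_c}(0,x) ≤ C R^{3−a}` for all `R ≥ 1` (`a > 0`) ⟹
`OneArmPolyDecayAtCritical 3 (min(a,1)/90) (2^66 + 3√C)` — exponent `a′/90` against the zone rows `a′/440` (`…_numeral`, p267314) and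
`a′/250` (`…_freeEps`, p269802) for the same hypothesis.
builds on p205010 (kernel theorem, internal audit signed; external expert review pending).
[cite: Cerf2015, Lemma 6.1, Lemma 7.1 and §10] [cite: DuminilcopinKozmaTassion2020, §7 (38)–(40)] [cite: HeydenreichVanDerHofstad2017, Open Problem 10.1] -/
theorem oneArmPolyDecayAtCritical_Z3_of_ballTwoPoint_pair {a C : ℝ} (ha0 : 0 < a)
    (hS : ∀ R : ℕ, 1 ≤ R → ∑ x ∈ box 3 R, tau 3 (criticalProbI 3) 0 x ≤ C * (R : ℝ) ^ (((3 : ℕ) : ℝ) - a)) :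
    OneArmPolyDecayAtCritical 3 (min a 1 / 90) ((2 : ℝ) ^ (66 : ℕ) + 3 * Real.sqrt C) := by
  exact oneArmPolyDecayAtCritical_Z3_of_minTwoPoint_pair ha0 (minTwoPoint_of_ballTwoPoint (d := 3) hS)

/-- **THE PRINTED CONDITIONAL POWER LAW ON `ℤ³`, PAIR ROUTE, BALL HYPOTHESIS.**  IF `Σ_{x ∈ Λ_R} P_{p_c}(0 ↔ x) ≤ C R^{3−a}` for all `R ≥ 1`
with `a > 0`, THEN for every `n ≥ 1`:  **`π_{p_c(ℤ³)}(n) ≤ (2^66 + 3√C) · n^{−min(a,1)/90}`** (exponent `a′/90` against `a′/440` through the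
uniqueness zone and `a′/250` through the free-ε zone).
builds on p205010 (kernel theorem, internal audit signed; external expert review pending).
[cite: Cerf2015, Lemma 6.1, Lemma 7.1 and §10] [cite: DuminilcopinKozmaTassion2020, §7 (38)–(40)] [cite: HeydenreichVanDerHofstad2017, Open Problem 10.1] -/
theorem oneArm_powerLaw_Z3_of_ballTwoPoint_pair {a C : ℝ} (ha0 : 0 < a)
    (hS : ∀ R : ℕ, 1 ≤ R → ∑ x ∈ box 3 R,
      (bondPercolation (zdGraph 3) (criticalProbI 3)).real (openConn 0 x) ≤ C * (R : ℝ) ^ ((3 : ℝ) - a)) :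
    ∀ n : ℕ, 1 ≤ n → oneArmProb 3 (criticalProbI 3) n ≤ ((2 : ℝ) ^ (66 : ℕ) + 3 * Real.sqrt C) * (n : ℝ) ^ (-(min a 1 / 90)) := by
  have h3 : (((3 : ℕ) : ℝ)) = (3 : ℝ) := by norm_num
  have hS' : ∀ R : ℕ, 1 ≤ R → ∑ x ∈ box 3 R, tau 3 (criticalProbI 3) 0 x ≤ C * (R : ℝ) ^ (((3 : ℕ) : ℝ) - a) := by
    intro R hR; rw [h3]; exact hS R hR
  exact fun n hn => oneArmPolyDecayAtCritical_Z3_of_ballTwoPoint_pair ha0 hS' n hn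

/-- **(T2) OF THE PAIR ROUTE ON `ℤ³`, BALL HYPOTHESIS**: X_A(3,a,C) ⟹ `ThetaHolderNearCritical 3 (2a′/(270 − a′)) (2^144 (C+1))`,
`a′ = min(a,1)`, i.e. **`θ(p) ≤ 2^144 (C+1) (p − p_c)^{2a′/(270−a′)}`** for `p ≥ p_c(ℤ³)` — the lane's Newman/two-box transfer
(`thetaHolder_Z3_of_oneArmPolyDecay_numeral'`, `c = a′/90 ≤ 1/4`) applied to the pair-route row; exponent `2/269` at `a′ = 1` against
`2/1319` (packaged zone, p267979) and `2/749` (free ε, p271087).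
builds on p205010 (kernel theorem, internal audit signed; external expert review pending).
[cite: Newman1987BetaDelta, Theorem (β ≥ 2/δ)] [cite: Cerf2015, Lemma 7.1 and §10] [cite: DuminilcopinKozmaTassion2020, §7 (38)–(40)] -/
theorem thetaHolder_Z3_of_ballTwoPoint_pair {a C : ℝ} (ha0 : 0 < a)
    (hS : ∀ R : ℕ, 1 ≤ R → ∑ x ∈ box 3 R, tau 3 (criticalProbI 3) 0 x ≤ C * (R : ℝ) ^ (((3 : ℕ) : ℝ) - a)) :
    ThetaHolderNearCritical 3 (2 * min a 1 / (270 - min a 1)) ((2 : ℝ) ^ (144 : ℕ) * (C + 1)) := by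
  have hC1 : 1 ≤ C := one_le_const_of_ballTwoPoint (criticalProbI 3) hS
  have hC0 : 0 ≤ C := by linarith
  have h1 := oneArmPolyDecayAtCritical_Z3_of_ballTwoPoint_pair ha0 hS
  have hc0 : 0 < min a 1 / 90 := by have := lt_min ha0 one_pos; positivity
  have hc : min a 1 / 90 ≤ 1 / 4 := by have := min_le_right a 1; linarith
  have hC' : 0 ≤ (2 : ℝ) ^ (66 : ℕ) + 3 * Real.sqrt C := by positivity
  have h2 := thetaHolder_Z3_of_oneArmPolyDecay_numeral' hc0 hc hC' h1
  have hexp : 2 * (min a 1 / 90) / (((3 : ℕ) : ℝ) - min a 1 / 90) = 2 * min a 1 / (270 - min a 1) := by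
    have key : (((3 : ℕ) : ℝ) - min a 1 / 90) = (270 - min a 1) / 90 := by push_cast; ring
    rw [key, div_div_eq_mul_div]
    congr 1; ring
  rw [hexp] at h2
  refine thetaHolderNearCritical_const_mono h2 ?_
  -- `16(2C′ + 125 + 108C′²) + 2 ≤ 2^144 (C+1)` with `C′ = A + 3s`, `A = 2^66`, `s = √C`, `s² = C`, `2^144 = 2^12 A²`
  have hs := Real.sq_sqrt hC0
  set s := Real.sqrt C with hsdef
  have hsC : 0 ≤ s := Real.sqrt_nonneg C
  have h144 : (2 : ℝ) ^ (144 : ℕ) = (2 : ℝ) ^ (12 : ℕ) * ((2 : ℝ) ^ (66 : ℕ)) ^ 2 := by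
    rw [← pow_mul, ← pow_add]
  rw [h144, ← hs]
  generalize hA : (2 : ℝ) ^ (66 : ℕ) = A
  have hA16 : 16 ≤ A := by rw [← hA]; norm_num
  have hA2 : 256 ≤ A ^ 2 := by nlinarith [hA16]
  have hAs : 6 * A * s ≤ A ^ 2 + 9 * s ^ 2 := by nlinarith [sq_nonneg (A - 3 * s)]
  have hB : 6 * s ≤ 3 * s ^ 2 + 3 := by nlinarith [sq_nonneg (s - 1)]
  have hP : 256 * s ^ 2 ≤ A ^ 2 * s ^ 2 := mul_le_mul_of_nonneg_right hA2 (sq_nonneg s)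
  have hQ : 32 * A ≤ 2 * A ^ 2 := by nlinarith [hA16]
  have h12 : (2 : ℝ) ^ (12 : ℕ) = 4096 := by norm_num
  rw [h12]
  nlinarith [hAs, hB, hP, hQ, hA2, sq_nonneg s]

end Summit.CriticalPhenomena.PercolationContinuityZ3.Theorems.Quant

end
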